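import Literature.AlgebraicGeometry.Frobenioids.ArchimedeanSlitRegion
import Literature.AlgebraicGeometry.Frobenioids.AngularFrobenioids
import HarnessLib

/-!
# Frobenioids II, Remark 3.4.1: linear monomorphisms of `N₀`, `R₀` that do not project to monomorphisms of `D₀`

Mochizuki, *The geometry of Frobenioids II: poly-Frobenioids*, Kyushu J. Math. **62** (2008)
401–460, §3, Remark 3.4.1, author's text p. 33 [cite: MochizukiFrdII2008, Rmk 3.4.1 p.33]:
"by using angular regions whose projections to `S¹` fail to intersect `{1, −1}` [cf. Lemma 3.2, (ii)],
one may construct examples of linear monomorphisms `φ : A → B` of `G₀`, where `A` is complex, and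
`B` is real [so the projection of `φ` to `D₀` is not a monomorphism]."

This file CONSTRUCTS the example and proves its properties, discharging the existence statement
`ArchFrd.Rmk341` (file `ArchimedeanFSM.lean`) at the level of `N₀` and `R₀`:
* the *upper region* `upperRegion t` (angular part the open upper half circle `{Im > 0}`, which misses
  `{1, −1}`; an `AngularRegion`: open, connected as the image of `(0, π)` under `θ ↦ e^{iθ}`);
* the complex object `A = upperObj t` of `N₀` and the linear isometry `φ : A → B` to the real object of
  the same tip, with `C₀`-data `(Spec ℂ → Spec ℝ, 1, 1)`;
* `φ` is a monomorphism of `N₀`: two arrows `W ⇉ A` equalised by `φ` have equal scalars and degrees,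
  and equal bases — for bases differing by complex conjugation would put both `a` and `conj(a)` in the
  upper region (`N0.mono_upperToReal`);
* its projection `Spec ℂ → Spec ℝ` is not a monomorphism of `D₀` (`D0.not_mono_toRealHom`);
* the same arrow in the slice `R₀ = (N₀)_{A_ℝ}`.
-/

namespace Literature.AlgebraicGeometry.Frobenioids

open CategoryTheory Complex
open scoped Pointwise NNReal

noncomputable section

namespace ArchFrd

/-! ### The upper region `{Im > 0} × (0, t]` -/

/-- The open upper half circle `{z ∈ S¹ | Im z > 0}` is the image of `(0, π)` under `θ ↦ e^{iθ}`.
[cite: MochizukiFrdII2008, Rmk 3.4.1 p.33] -/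
theorem image_expUnit_Ioo_zero_pi :
    expUnit '' Set.Ioo 0 Real.pi = {z : normOneSubgroup ℂ | 0 < ((z : ℂˣ) : ℂ).im} := by
  ext z
  constructor
  · rintro ⟨θ, hθ, rfl⟩
    change 0 < (((expUnit θ : ℂˣ) : ℂ)).im
    rw [coe_expUnit, exp_ofReal_mul_I_im]
    exact Real.sin_pos_of_pos_of_lt_pi hθ.1 hθ.2
  · intro hz
    change 0 < ((z : ℂˣ) : ℂ).im at hz
    refine ⟨arg ((z : ℂˣ) : ℂ), ⟨?_, ?_⟩, expUnit_arg z⟩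
    · rcases (arg_nonneg_iff.mpr hz.le).lt_or_eq with h | h
      · exact h
      · exact absurd (arg_eq_zero_iff.mp h.symm).2 hz.ne'
    · exact arg_lt_pi_iff.mpr (Or.inr hz.ne')

/-- The *upper region* of tip `t`: angular part the open upper half circle (it "fails to intersect
`{1, −1}`"). [cite: MochizukiFrdII2008, Rmk 3.4.1 p.33] -/
def upperRegion (t : PosReal) : AngularRegion ℂ where
  dir := {z | 0 < ((z : ℂˣ) : ℂ).im}
  tip := t
  isOpen_dir :=
    (isOpen_lt continuous_const (Complex.continuous_im.comp
      (Units.continuous_val.comp continuous_subtype_val)))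
  isConnected_inter z := by
    rw [connectedComponent_eq_univ' z, Set.inter_univ, ← image_expUnit_Ioo_zero_pi]
    exact (isConnected_Ioo Real.pi_pos).image _ continuous_expUnit.continuousOn

/-- Membership in the angular part of the upper region. [cite: MochizukiFrdII2008, Rmk 3.4.1 p.33] -/
@[simp] theorem mem_upperRegion_dir_iff (t : PosReal) (z : normOneSubgroup ℂ) :
    z ∈ (upperRegion t).dir ↔ 0 < ((z : ℂˣ) : ℂ).im := Iff.rfl

/-- The imaginary part of the angular part of `u` has the sign of `Im u` (it is `Im u / |u|`).
[cite: MochizukiFrdII2008, Def 3.1 (ii) p.24] -/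
theorem im_unitPart (u : ℂˣ) :
    (((unitPart ℂ u : normOneSubgroup ℂ) : ℂˣ) : ℂ).im = (u : ℂ).im / ‖(u : ℂ)‖ := by
  change (((u * (ofPosReal ℂ (absHom ℂ u))⁻¹ : ℂˣ)) : ℂ).im = _
  rw [Units.val_mul, Units.val_inv_eq_inv_val, coe_ofPosReal, coe_absHom, ← div_eq_mul_inv]
  change ((u : ℂ) / ((‖(u : ℂ)‖ : ℝ) : ℂ)).im = _
  rw [Complex.div_ofReal_im]

/-- A unit lies over the upper region's angular part iff its imaginary part is positive.
[cite: MochizukiFrdII2008, Rmk 3.4.1 p.33] -/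
theorem unitPart_mem_upper_iff (t : PosReal) (u : ℂˣ) :
    unitPart ℂ u ∈ (upperRegion t).dir ↔ 0 < (u : ℂ).im := by
  rw [mem_upperRegion_dir_iff, im_unitPart]
  exact div_pos_iff_of_pos_right (norm_pos_iff.mpr u.ne_zero)

/-- The upper region is not stable under complex conjugation: no `a` has both `a` and `conj a` in it.
[cite: MochizukiFrdII2008, Rmk 3.4.1 p.33] -/
theorem not_mem_upper_of_star_mem (t : PosReal) {a : ℂˣ} (ha : a ∈ (upperRegion t).carrier) :
    star a ∉ (upperRegion t).carrier := by
  intro hs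
  have h1 : 0 < (a : ℂ).im := (unitPart_mem_upper_iff t a).mp ha.1
  have h2 : 0 < ((star a : ℂˣ) : ℂ).im := (unitPart_mem_upper_iff t (star a)).mp hs.1
  rw [Units.coe_star, Complex.star_def, Complex.conj_im] at h2
  linarith

/-! ### The example in `C₀`: `(Spec ℂ → Spec ℝ, 1, 1)` from the upper object to the real object -/

namespace C0

/-- The complex object `A` with the upper region of tip `t`. [cite: MochizukiFrdII2008, Rmk 3.4.1 p.33] -/
def upperObj (t : PosReal) : C0 := ⟨.complex, upperRegion t, fun h => D0.noConfusion h⟩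

/-- The arrow `A → B` of Remark 3.4.1 in `C₀`: base `Spec ℂ → Spec ℝ`, degree `1`, scalar `1`, to the
real object `B` of the same tip. [cite: MochizukiFrdII2008, Rmk 3.4.1 p.33] -/
def upperToReal (t : PosReal) : upperObj t ⟶ realOfTip t where
  base := D0.toRealHom
  degFr := 1
  scalar := 1
  scalar_mem := Subgroup.mem_top _
  mapsTo := by
    rw [one_smul, PNat.one_coe, pow_one]
    change (upperRegion t).carrier ⊆ D0.galAct (D0.Hom.twists D0.toRealHom) '' (realOfTip t).region.carrier
    rw [D0.twists_toRealHom, D0.image_galAct_false]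
    intro u hu
    rw [mem_carrier_of_isIsotropic ((realOfTip t).isIsotropic_of_isReal rfl)]
    exact hu.2

/-- `A → B` is an isometry (same tip, scalar of norm `1`). [cite: MochizukiFrdII2008, Rmk 3.4.1 p.33] -/
theorem isIsometry_upperToReal (t : PosReal) :
    PreFrobenioid.IsIsometry C0.toElem (upperToReal t) := by
  rw [A0.isIsometry_iff_norm_mul_tip_pow]
  change ‖((1 : ℂˣ) : ℂ)‖ * (t : ℝ) ^ ((1 : ℕ+) : ℕ) = (t : ℝ)
  rw [Units.val_one, norm_one, one_mul, PNat.one_coe, pow_one]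

/-- Two DIFFERENT twists compose to complex conjugation. [cite: MochizukiFrdII2008, Def 3.1 (i) p.23] -/
theorem _root_.Literature.AlgebraicGeometry.Frobenioids.ArchFrd.D0.galAct_galAct_of_ne {σ τ : Bool}
    (h : σ ≠ τ) (u : ℂˣ) : D0.galAct τ (D0.galAct σ u) = star u := by
  cases σ <;> cases τ <;> simp_all

/-- Arrows of `D₀` into `Spec ℂ` with the same twist are equal. [cite: MochizukiFrdII2008, §3 p.23] -/
theorem _root_.Literature.AlgebraicGeometry.Frobenioids.ArchFrd.D0.eq_of_twists_eq {L : D0}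
    (f g : L ⟶ D0.complex) (h : D0.Hom.twists f = D0.Hom.twists g) : f = g := by
  cases f with
  | gal σ =>
    cases g with
    | gal τ =>
      rw [D0.twists_gal, D0.twists_gal] at h
      rw [h]

/-- The core of Remark 3.4.1: two arrows `W ⇉ A` of `C₀` equalised by `A → B` are equal (equal degrees
and scalars by the composite law; equal bases since otherwise both `a` and `conj a` would lie in the
upper region). [cite: MochizukiFrdII2008, Rmk 3.4.1 p.33] -/
theorem eq_of_comp_upperToReal (t : PosReal) {W : C0} (g h : W ⟶ upperObj t)
    (e : g ≫ upperToReal t = h ≫ upperToReal t) : g = h := by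
  have hd : degFr g = degFr h := by
    have := congrArg degFr e
    rw [degFr_comp', degFr_comp'] at this
    exact mul_right_cancel this
  have hs : scalar g = scalar h := by
    have := congrArg scalar e
    rw [scalar_comp', scalar_comp'] at this
    change (Base g).act 1 * scalar g ^ ((1 : ℕ+) : ℕ) = (Base h).act 1 * scalar h ^ ((1 : ℕ+) : ℕ)
      at this
    rwa [map_one, map_one, one_mul, one_mul, PNat.one_coe, pow_one, pow_one] at this
  refine hom_ext ?_ hd hs
  -- bases: same twist, else `a` and `conj a` both in the upper region
  apply D0.eq_of_twists_eq
  by_contra hne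
  obtain ⟨w, hw, -⟩ := exists_mem_boundary W.region
  obtain ⟨a₁, ha₁, e₁⟩ := g.mapsTo (Set.smul_mem_smul_set (Set.pow_mem_pow hw (n := (degFr g : ℕ))))
  obtain ⟨a₂, ha₂, e₂⟩ := h.mapsTo (Set.smul_mem_smul_set (Set.pow_mem_pow hw (n := (degFr h : ℕ))))
  change D0.galAct (D0.Hom.twists (Base g)) a₁ = scalar g • w ^ (degFr g : ℕ) at e₁
  change D0.galAct (D0.Hom.twists (Base h)) a₂ = scalar h • w ^ (degFr h : ℕ) at e₂
  -- `galAct τ a₂ = galAct σ a₁` with `σ ≠ τ`, so `a₂ = conj a₁`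
  have key : D0.galAct (D0.Hom.twists (Base h)) a₂ = D0.galAct (D0.Hom.twists (Base g)) a₁ := by
    rw [e₁, e₂, ← hs, ← hd]
  have hx : a₂ = star a₁ := by
    rw [← D0.galAct_galAct (D0.Hom.twists (Base h)) a₂, key]
    exact D0.galAct_galAct_of_ne hne a₁
  exact not_mem_upper_of_star_mem t ha₁ (hx ▸ ha₂)

end C0

/-! ### The example in `N₀` and in `R₀` -/

namespace N0

/-- `A`, the complex upper object, in `N₀`. [cite: MochizukiFrdII2008, Rmk 3.4.1 p.33] -/
def upperObj (t : PosReal) : N0 := ⟨⟨C0.upperObj t⟩⟩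

/-- `B`, the real object of tip `t`, in `N₀`. [cite: MochizukiFrdII2008, Rmk 3.4.1 p.33] -/
def realObj (t : PosReal) : N0 := ⟨⟨C0.realOfTip t⟩⟩

/-- The linear isometry `φ : A → B` of Remark 3.4.1 as an arrow of `N₀`. [cite: MochizukiFrdII2008, Rmk 3.4.1 p.33] -/
def upperToReal (t : PosReal) : upperObj t ⟶ realObj t :=
  homMk (C0.upperToReal t) (C0.isIsometry_upperToReal t) rfl

/-- `φ` is a monomorphism of `N₀`. [cite: MochizukiFrdII2008, Rmk 3.4.1 p.33] -/
theorem mono_upperToReal (t : PosReal) : Mono (upperToReal t) := by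
  refine ⟨fun {W} g h e => hom_ext ?_⟩
  have e' := congrArg homCarrier e
  rw [homCarrier_comp, homCarrier_comp] at e'
  exact C0.eq_of_comp_upperToReal t _ _ e'

/-- `φ` projects to `Spec ℂ → Spec ℝ`, which is not a monomorphism of `D₀`.
[cite: MochizukiFrdII2008, Rmk 3.4.1 p.33] -/
theorem not_mono_toD0_upperToReal (t : PosReal) : ¬ Mono (N0.toD0.map (upperToReal t)) :=
  D0.not_mono_toRealHom

/-- **Remark 3.4.1** for `G₀ = N₀`: a linear monomorphism from a complex to a real object whose
projection to `D₀` is not a monomorphism — EXHIBITED. [cite: MochizukiFrdII2008, Rmk 3.4.1 p.33] -/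
theorem exists_mono_not_projecting :
    ∃ (X Y : N0) (φ : X ⟶ Y), Mono φ ∧ X.carrier.IsComplexObj ∧ Y.carrier.IsRealObj ∧
      ¬ Mono (N0.toD0.map φ) :=
  ⟨upperObj 1, realObj 1, upperToReal 1, mono_upperToReal 1, rfl, rfl, not_mono_toD0_upperToReal 1⟩

end N0

namespace R0

/-- `B` of tip `t` over the chosen real unit object (the rescaling `t ↦ 1`), as an object of
`R₀ = (N₀)_{A_ℝ}`. [cite: MochizukiFrdII2008, Rmk 3.4.1 p.33] -/
def realObj (t : PosReal) : R0 :=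
  Over.mk (N0.realRescale (N0.realObj t) N0.realUnit rfl rfl)

/-- `A`, the complex upper object, as an object of `R₀` (structure map through `B`).
[cite: MochizukiFrdII2008, Rmk 3.4.1 p.33] -/
def upperObj (t : PosReal) : R0 :=
  Over.mk (N0.upperToReal t ≫ N0.realRescale (N0.realObj t) N0.realUnit rfl rfl)

/-- The arrow `φ : A → B` in `R₀`. [cite: MochizukiFrdII2008, Rmk 3.4.1 p.33] -/
def upperToReal (t : PosReal) : upperObj t ⟶ realObj t := Over.homMk (N0.upperToReal t) rfl

/-- `φ` is a monomorphism of `R₀` (monomorphisms of `N₀` stay monomorphisms in the slice).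
[cite: MochizukiFrdII2008, Rmk 3.4.1 p.33] -/
theorem mono_upperToReal (t : PosReal) : Mono (upperToReal t) := by
  have hm := N0.mono_upperToReal t
  refine ⟨fun {W} g h e => Over.OverMorphism.ext ?_⟩
  have e' := congrArg CommaMorphism.left e
  change g.left ≫ N0.upperToReal t = h.left ≫ N0.upperToReal t at e'
  exact hm.right_cancellation _ _ e'

/-- **Remark 3.4.1** for `G₀ = R₀` — EXHIBITED. [cite: MochizukiFrdII2008, Rmk 3.4.1 p.33] -/
theorem exists_mono_not_projecting :
    ∃ (X Y : R0) (φ : X ⟶ Y), Mono φ ∧ (R0.toC0.obj X).IsComplexObj ∧ (R0.toC0.obj Y).IsRealObj ∧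
      ¬ Mono (R0.toD0.map φ) :=
  ⟨upperObj 1, realObj 1, upperToReal 1, mono_upperToReal 1, rfl, rfl, D0.not_mono_toRealHom⟩

end R0

end ArchFrd

end

end Literature.AlgebraicGeometry.Frobenioids
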